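import Literature.Algebra.Lie.GradedJacobsonMorozovLinear
import Literature.Algebra.Lie.LefschetzModulePrimitive
import Literature.Algebra.Lie.Sl2ModuleWeights
import Literature.AlgebraicGeometry.HodgeTheory.MonodromyWeightFiltrationSl2
import Mathlib.LinearAlgebra.Eigenspace.Triangularizable
import HarnessLib

/-!
# Filtered Lefschetz modules: the bigrading `h = h_hor + h_ver` of Looijenga–Lunts (5.3)

Topic `Literature/Algebra/Lie` (namespace `Literature.Algebra.Lie`).  Lane `lit-hodgefound` (Track 2 foundations
library), skeleton seat `lit-hodgefound-skel-1` (generation 46), row **A1-148** of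
`run/shared/lean/pub/lit-hodgefound/SKELETON.md`: the algebraic core of Looijenga–Lunts' §5 (5.3) — for a `ℤ`-graded
finite-dimensional `(M, h)` and an operator `e` of degree `2` there is an `𝔰𝔩₂`-triple `(e, h_hor, f)` of `𝔤𝔩(M)` with
`h_hor` of degree `0` and `f` of degree `-2` (row A1-146, Looijenga–Lunts (5.2)), and then **`h = h_hor + h_ver`** with
`h_ver := h - h_hor` commuting with the whole triple, `h_hor`, `h_ver` diagonalisable with integral eigenvalues and
commuting, their simultaneous eigenspaces `M_{k,l}` a BIGRADING of `M` refining the grading (`M_n = ⊕_{k+l=n} M_{k,l}`),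
the "horizontal filtration" `hor^k M = ⊕_{j ≥ k} M_j(h_hor)` being the Lefschetz (= monodromy weight) filtration of `e`,
raised by `e`, lowered by `f`, preserved by `h_ver`, and split by the eigenspaces of `h_hor`.  As in A1-146 /
`JacobsonMorozovLinear.lean` everything is stated by RING IDENTITIES in `Module.End K M` and in the vocabulary of A1-88
(`IsZGrading`, `degreeSpace`) and of the tree's `IsMonodromyWeightFiltration` — no Lie instance on `End(M)` is needed to
USE the file (Mathlib's commutator structure `LieRing.ofAssociativeRing` is invoked by `letI` inside proofs only).
THEOREMS ONLY (no definition, no named fact, no `sorry`, no instance; D-0026 net debt `0`).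

## Source, VERBATIM

E. Looijenga, V. A. Lunts, *A Lie algebra attached to a projective variety*, Invent. Math. **129** (1997) 361–412
(held TeX text `paper:arxiv-alg-geom_9604014`), §5 (5.3), p0021 L1–L37:

> "Let `(𝔞, M)` be a Lefschetz module and `hor^• M` a nonincreasing filtration on the graded vector space underlying `M`
> (so `hor^k M = ⊕_l hor^k M_l`) which is preserved by `𝔞`. We shall refer to this filtration as the horizontal
> filtration. Then the associated vertical filtration is defined by `ver_k M := Σ_r hor^{r-k} M_r`. […]
> Suppose now that some `a ∈ 𝔞` preserves the vertical grading (i.e., `e_a(hor^k M) ⊂ hor^{k+2} M` for all `k`) and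
> has the Lefschetz property in `Gr_hor M` […]. It is then immediate that the horizontal filtration is the Lefschetz
> filtration of the transformation `e_a` in `M`. If we apply 5.2 to `e := e_a` and `𝔰 := ℂh`, we find an `𝔰𝔩₂`-triple
> `(e_a, h_hor, f_a)` in `𝔤(𝔞, M)` with `f_a` of total degree `-2` and `h_hor` of total degree `0`. So `f_a` will map
> `hor^k M_r` to `hor^{k-2} M_{r-2}`. This shows that `f_a` preserves the vertical filtration. It also follows that
> `h_hor = [e_a, f_a]` has this property. It is clear that the eigen spaces of `h_hor` split the horizontal filtration.
> This element commutes with `h`, so if we put `h_ver := h - h_hor`, then the eigen spaces of the commuting pair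
> `(h_hor, h_ver)` define a bigrading of `M` that identifies `M` with `Gr M`. […]
> **Proposition.** […] Then we can write `h = h_hor + h_ver` with `h_hor` and `h_ver` semisimple elements of `𝔤(𝔞, M)`
> that have integral eigen values and commute with each other (so for the resulting bigrading of `M`, `M_{k,l}` gets
> identified with `Gr^k_hor M_{k+l}`)."

and (5.1) p0020 L99–L106: "If `e` is a nilpotent transformation in a vector space `M`, then there is a unique
nonincreasing filtration `W^•` preserved by `e` such that `e` has the Lefschetz property in `Gr^•_W(M)`. Any
`𝔰𝔩₂`-triple `(e, h, f)` containing `e` […] splits the filtration (so the `k`-eigen space of `h` is a supplement of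
`W^{k+1}` in `W^k`). We shall refer to `W^•` as the Lefschetz filtration of `e`."

## Rendering (dictionary)

* `(M, h)` `ℤ`-graded = `IsZGrading h` (A1-88; `M_n = degreeSpace h n`); "`e` of degree `2`" = `h * e - e * h = 2 • e`.
* the `𝔰𝔩₂`-triple `(e_a, h_hor, f_a)` = ring identities `H * e - e * H = 2 • e`, `H * F - F * H = -(2 • F)`,
  `e * F - F * e = H`, `H ≠ 0` for `H = h_hor`, `F = f_a`; "`h_hor` of total degree `0`" = `h * H = H * h`; "`f_a` of
  total degree `-2`" = `h * F - F * h = -(2 • F)`; `h_ver = h - H`.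
* `M_{k,l}` = `degreeSpace H k ⊓ degreeSpace (h - H) l`; the horizontal filtration `hor^k M = ⨆_{j ≥ k} degreeSpace H j`
  (decreasing); "Lefschetz filtration of `e`" = the tree's `IsMonodromyWeightFiltration e 0 W` for the increasing
  reindexing `W_i = hor^{-i} M` (Cattani et al., App. A: `N W_i ⊆ W_{i-2}`, `N^ℓ : Gr_ℓ ⥲ Gr_{-ℓ}`).

## Contents (all proved; `K` a field of characteristic `0`, `M` finite-dimensional)

* §1 **`IsZGrading.exists_sl2Triple_of_degree_two`** — "(5.2) applied to `e := e_a` and `𝔰 := ℂh`": for `ℤ`-graded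
  `(M, h)` and `e ≠ 0` of degree `2` there are `H, F` with `(e, H, F)` an `𝔰𝔩₂`-triple, `hH = Hh`, `hF - Fh = -2F`
  (A1-146; `e` is nilpotent by A1-88 `pow_finrank_eq_zero`).
* §2 for such a triple (only `hH = Hh` and the `𝔰𝔩₂`-relations are used): `sub_mul_comm_of_sl2Triple` /
  `sub_mul_comm_e` / `sub_mul_comm_f` ("`h_ver := h - h_hor` … commuting": `h_ver` commutes with `H`, and with `e`, `F`
  when `e`, `F` have `h`-degrees `2`, `-2`); **`isZGrading_h_of_sl2Triple`** (`h_hor` is diagonalisable with integral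
  eigenvalues — Bourbaki VIII §1 Cor. of Prop. 2, the tree's `IsSl2Triple.iSup_eigenspace_toEnd_h_intCast_eq_top`);
  **`iSup_degreeSpace_inf_degreeSpace_eq_top_of_commute`** / `iSupIndep_degreeSpace_inf_degreeSpace_of_commute` /
  **`isInternal_degreeSpace_inf_degreeSpace_of_commute`** (two commuting `ℤ`-diagonalisable operators have a joint
  eigenspace decomposition `M = ⊕_{(k,l)} M_k(A) ⊓ M_l(B)`); **`isZGrading_sub_of_sl2Triple`** (`h_ver` is diagonalisable
  with integral eigenvalues); **`isInternal_bidegreeSpace`** (the BIGRADING `M = ⊕_{k,l} M_{k,l}`,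
  `M_{k,l} = degreeSpace H k ⊓ degreeSpace (h - H) l`) and **`degreeSpace_eq_iSup_bidegreeSpace`**
  (`M_n = ⊕_k M_{k,n-k}` for any `ℤ`-diagonalisable `H` commuting with `h`: the bigrading refines the grading).
* §3 the horizontal filtration `hor^k = ⨆_{j ≥ k} M_j(H)`: `map_e_horFiltration_le` (`e hor^k ⊆ hor^{k+2}`),
  `map_f_horFiltration_le` (`F hor^k ⊆ hor^{k-2}`: "`f_a` will map `hor^k M_r` to `hor^{k-2} M_{r-2}`"),
  `map_sub_horFiltration_le` (`h_ver` preserves it), **`horFiltration_eq_sup`** / `disjoint_degreeSpace_horFiltration`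
  ("the eigen spaces of `h_hor` split the horizontal filtration": `hor^k = M_k(H) ⊕ hor^{k+1}`), and
  **`isMonodromyWeightFiltration_horFiltration`** ("the horizontal filtration is the Lefschetz filtration of the
  transformation `e_a` in `M`": `i ↦ hor^{-i}` is THE monodromy weight filtration of `e` centred at `0`, by the tree's
  `IsSl2Triple.isMonodromyWeightFiltration_biSup_eigenspace_neg` and its uniqueness theorem).

* §4 (rider) **`horFiltration_inf_degreeSpace_eq`** ("`hor^k M = ⊕_l hor^k M_l`": `hor^k ∩ M_n = ⊕_{j ≥ k} M_{j,n-j}`,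
  via the support lemma `coe_decompose_eq_zero_of_mem_biSup`), **`horFiltration_inf_degreeSpace_eq_sup`** +
  `disjoint_bidegreeSpace_horFiltration_inf` ("`M_{k,l}` gets identified with `Gr^k_hor M_{k+l}`":
  `hor^k ∩ M_n = M_{k,n-k} ⊕ (hor^{k+1} ∩ M_n)`), `degreeSpace_eq_iSup_inf_of_commute`, **`verFiltration_eq`** (the
  vertical filtration `ver_k M := Σ_r hor^{r-k} M_r` equals `⊕_{m ≤ k} M_m(h_ver)`) and `map_verFiltration_le_of_commute`
  ("`f_a` preserves the vertical filtration … `h_hor` has this property").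

* §5 **`IsZGrading.mulLeft_sub_mulRight`** (`𝔤𝔩(M)` is `ℤ`-graded by `ad H = (X ↦ HX - XH)` for a
  `ℤ`-diagonalisable `H`), **`isInternal_degreeSpace_mulLeft_sub_mulRight`** ("the eigen spaces of `(h_hor, h_ver)`
  under the adjoint representation also define a bigrading" — of `𝔤𝔩(M)`), `apply_mem_bidegreeSpace_of_mem`
  (bidegree-`(k,l)` operators map `M_{i,j}` to `M_{i+k,j+l}`).
* §6 **`eq_iSup_inf_degreeSpace_of_forall_mem`** / **`eq_iSup_inf_bidegreeSpace_of_forall_mem`** /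
  `iSupIndep_inf_bidegreeSpace` / **`isInternal_comap_subtype_bidegreeSpace_of_forall_mem`** — a subspace invariant
  under (two commuting) `ℤ`-diagonalisable operators is (bi)graded by their eigenspaces; with §5 this is the printed
  "… also define a bigrading of `𝔤(𝔞, M)`" for every `ad h_hor`-, `ad h_ver`-stable subspace of `𝔤𝔩(M)` (the Lie
  subalgebra form is in `LefschetzModuleHomogeneousSl2.lean` §3).

## SCOPE

(a) The Lefschetz-module clauses of (5.3) — `h_hor, h_ver ∈ 𝔤(𝔞, M)` (A1-147 puts the triple inside `𝔤(𝔞, M)`),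
`𝔞_{2,0}`, `𝔤(𝔞_{2,0}, M_hor) ≅ 𝔤(𝔞_hor, Gr_hor M)`, and the second half on `Gr^ver` — are not formalised here; the
filtrations `hor^k`, `ver_k` are written out as `⨆`'s, no definition is introduced.  (b) The Leray
application (5.4)–(5.7) is geometry, not formalised.  (c) Nothing here concerns complex tori or the Hodge conjecture.

## References

* [LooijengaLunts1997] E. Looijenga, V. A. Lunts, *A Lie algebra attached to a projective variety*, Invent. Math. 129
  (1997) 361–412; arXiv:alg-geom/9604014. §5 (5.1) p. 20 L99–L106, (5.2) p. 20 L108–L121, (5.3) p. 21 L1–L37 of the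
  held TeX text.
* [Bourbaki2008LieGroups79] N. Bourbaki, *Lie Groups and Lie Algebras, Chapters 7–9*, Ch. VIII §1 no. 2 Cor. of
  Prop. 2 — via the tree's `Sl2ModuleWeights.lean`.
* [CattaniElZeinGriffithsLe2014] E. Cattani et al. (eds.), *Hodge Theory*, Math. Notes 49, App. A Prop. A.2.2, (A.3.4) —
  via the tree's `MonodromyWeightFiltration[Sl2].lean`.
-/

namespace Literature.Algebra.Lie

open Module Function Set LieAlgebra
open Literature.AlgebraicGeometry.HodgeTheory (IsMonodromyWeightFiltration)

universe u v

section Bigrading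

variable {K : Type u} [Field K] [CharZero K] {V : Type v} [AddCommGroup V] [Module K V] [FiniteDimensional K V]

/-! ### §1 "(5.2) applied to `e := e_a` and `𝔰 := ℂh`": the triple `(e_a, h_hor, f_a)` -/

omit [CharZero K] [FiniteDimensional K V] in
/-- An operator of `h`-degree `2` in the ring-identity form, `h e - e h = 2 e`, raises degrees by `2`
(A1-88 `mapsTo_of_lie_eq_two_nsmul`, commutator spelled out). [cite: LooijengaLunts1997, §1 (1.1) p. 3 L106–L111] -/
theorem mapsTo_degreeSpace_of_commutator_eq_two_smul {h e : Module.End K V} (hhe : h * e - e * h = (2 : K) • e)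
    (k : ℤ) : MapsTo e (degreeSpace h k) (degreeSpace h (k + 2)) := by
  intro x hx
  rw [SetLike.mem_coe, mem_degreeSpace_iff] at hx ⊢
  have h1 := LinearMap.congr_fun hhe x
  rw [LinearMap.sub_apply, Module.End.mul_apply, Module.End.mul_apply, hx, map_smul, LinearMap.smul_apply,
    sub_eq_iff_eq_add] at h1
  rw [h1, ← add_smul, Int.cast_add, Int.cast_two, add_comm]

omit [CharZero K] [FiniteDimensional K V] in
/-- … and one of degree `-2`, `h f - f h = -2 f`, lowers them by `2`. [cite: LooijengaLunts1997, §1 (1.1) p. 3 L106–L111] -/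
theorem mapsTo_degreeSpace_of_commutator_eq_neg_two_smul {h f : Module.End K V}
    (hhf : h * f - f * h = -((2 : K) • f)) (k : ℤ) : MapsTo f (degreeSpace h k) (degreeSpace h (k - 2)) := by
  intro x hx
  rw [SetLike.mem_coe, mem_degreeSpace_iff] at hx ⊢
  have h1 := LinearMap.congr_fun hhf x
  rw [LinearMap.sub_apply, Module.End.mul_apply, Module.End.mul_apply, hx, map_smul, LinearMap.neg_apply,
    LinearMap.smul_apply, sub_eq_iff_eq_add] at h1
  rw [h1, ← neg_smul, ← add_smul, Int.cast_sub, Int.cast_two, neg_add_eq_sub]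

/-- **"If we apply 5.2 to `e := e_a` and `𝔰 := ℂh`, we find an `𝔰𝔩₂`-triple `(e_a, h_hor, f_a)` … with `f_a` of total
degree `-2` and `h_hor` of total degree `0`"** — for a `ℤ`-graded finite-dimensional `(M, h)` (characteristic `0`) and
ANY non-zero `e` of degree `2` (`he - eh = 2e`; such an `e` is nilpotent, A1-88 `pow_finrank_eq_zero`) there are
`H, F ∈ End(M)` with `H ≠ 0`, `He - eH = 2e`, `HF - FH = -2F`, `eF - Fe = H` (an `𝔰𝔩₂`-triple `(e, H, F)`),
`hH = Hh` (`H = h_hor` of degree `0`) and `hF - Fh = -2F` (`F = f_a` of degree `-2`) — row A1-146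
(`IsZGrading.exists_sl2Triple_of_isNilpotent`, Looijenga–Lunts (5.2) for `𝔤𝔩(M)`).
[cite: LooijengaLunts1997, §5 (5.3) p. 21 L17–L19, (5.2) p. 20 L108–L121] -/
theorem IsZGrading.exists_sl2Triple_of_degree_two {h e : Module.End K V} (hgr : IsZGrading h) (he0 : e ≠ 0)
    (hhe : h * e - e * h = (2 : K) • e) :
    ∃ H F : Module.End K V, H ≠ 0 ∧ H * e - e * H = (2 : K) • e ∧ H * F - F * H = -((2 : K) • F) ∧
      e * F - F * e = H ∧ h * H = H * h ∧ h * F - F * h = -((2 : K) • F) := by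
  have hnil : IsNilpotent e :=
    ⟨Module.finrank K V, pow_finrank_eq_zero hgr (mapsTo_degreeSpace_of_commutator_eq_two_smul hhe)⟩
  have h2 : h * e - e * h = ((2 : ℤ) : K) • e := by rw [Int.cast_two]; exact hhe
  obtain ⟨H, F, hH0, h1, h2', h3, h4, h5⟩ := hgr.exists_sl2Triple_of_isNilpotent hnil he0 h2
  exact ⟨H, F, hH0, h1, h2', h3, h4, by rw [Int.cast_two] at h5; exact h5⟩

/-! ### §2 `h = h_hor + h_ver`: the bigrading -/

omit [CharZero K] [FiniteDimensional K V] in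
/-- **"This element commutes with `h`, so if we put `h_ver := h - h_hor` …"**: `h_ver = h - H` commutes with `H`.
[cite: LooijengaLunts1997, §5 (5.3) p. 21 L24–L26] -/
theorem sub_mul_comm_of_commute {h H : Module.End K V} (hhH : h * H = H * h) : (h - H) * H = H * (h - H) := by
  rw [sub_mul, mul_sub, hhH]

omit [CharZero K] [FiniteDimensional K V] in
/-- `h_ver = h - H` commutes with `e` when `e` has the same degree `2` for `h` and for `H` (`he - eh = 2e = He - eH`).
[cite: LooijengaLunts1997, §5 (5.3) p. 21 L24–L28] -/
theorem sub_mul_comm_of_commutator_eq {h H e : Module.End K V} {c : K} (hhe : h * e - e * h = c • e)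
    (hHe : H * e - e * H = c • e) : (h - H) * e = e * (h - H) := by
  rw [← sub_eq_zero, sub_mul, mul_sub, show h * e - H * e - (e * h - e * H) = (h * e - e * h) - (H * e - e * H) by abel,
    hhe, hHe, sub_self]

/-- **"`h_hor` … semisimple … integral eigen values"**: the middle element `H` of an `𝔰𝔩₂`-triple `(e, H, F)` of `𝔤𝔩(M)`
(`He - eH = 2e`, `HF - FH = -2F`, `eF - Fe = H`, `H ≠ 0`) is diagonalisable with integral eigenvalues, `M = ⊕_k M_k(H)`
(Bourbaki VIII §1 no. 2 Cor. (i) of Prop. 2, the tree's `IsSl2Triple.iSup_eigenspace_toEnd_h_intCast_eq_top`).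
[cite: LooijengaLunts1997, §5 (5.3) p. 21 L32–L36] [cite: Bourbaki2008LieGroups79, Ch. VIII §1 no. 2 Cor. (i) of Prop. 2] -/
theorem isZGrading_h_of_sl2Triple {H e F : Module.End K V} (hH0 : H ≠ 0) (h1 : H * e - e * H = (2 : K) • e)
    (h2 : H * F - F * H = -((2 : K) • F)) (h3 : e * F - F * e = H) : IsZGrading H := by
  letI : LieRing (Module.End K V) := LieRing.ofAssociativeRing
  letI : LieAlgebra K (Module.End K V) := LieAlgebra.ofAssociativeAlgebra
  have t : IsSl2Triple H e F :=
    { h_ne_zero := hH0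
      lie_e_f := h3
      lie_h_e_nsmul := by rw [← ofNat_smul_eq_nsmul K 2 e]; exact h1
      lie_h_f_nsmul := by rw [← ofNat_smul_eq_nsmul K 2 F]; exact h2 }
  have h4 := IsSl2Triple.iSup_eigenspace_toEnd_h_intCast_eq_top (k := K) (M := V) t
  simp only [LieModule.toEnd_module_end, LieHom.id_apply] at h4
  exact h4

omit [CharZero K] [FiniteDimensional K V] in
/-- A `ℤ`-grading is an internal direct sum `M = ⊕_{k ∈ ℤ} M_k` (the eigenspaces of an endomorphism are independent,
Mathlib `Module.End.eigenspaces_iSupIndep`, and `ℤ → K` is injective in characteristic `0`). [cite: LooijengaLunts1997, §1 (1.1) p. 3 L106–L111 ("ℤ-graded K-vector space")] -/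
theorem IsZGrading.isInternal_degreeSpace [CharZero K] {A : Module.End K V} (hA : IsZGrading A) :
    DirectSum.IsInternal fun k : ℤ ↦ degreeSpace A k :=
  DirectSum.isInternal_submodule_of_iSupIndep_of_iSup_eq_top
    (A.eigenspaces_iSupIndep.comp (f := fun k : ℤ ↦ (k : K)) Int.cast_injective) hA

omit [CharZero K] [FiniteDimensional K V] in
/-- The `A`-homogeneous components of a `B`-eigenvector are `B`-eigenvectors (same eigenvalue), for COMMUTING `A`, `B`
along a decomposition `M = ⊕_k M_k(A)` (A1-145 `coe_decompose_apply_add`: `B - l` has `A`-degree `0`). [cite: LooijengaLunts1997, §5 (5.3) p. 21 L24–L28 ("the eigen spaces of the commuting pair (h_hor, h_ver) define a bigrading")] -/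
theorem coe_decompose_mem_degreeSpace_of_commute {A B : Module.End K V} (hAB : A * B = B * A)
    [DirectSum.Decomposition fun k : ℤ ↦ degreeSpace A k] {l : ℤ} {v : V} (hv : v ∈ degreeSpace B l) (k : ℤ) :
    (DirectSum.decompose (fun k : ℤ ↦ degreeSpace A k) v k : V) ∈ degreeSpace B l := by
  have hdeg : ∀ j, ∀ x ∈ degreeSpace A j, (B - (l : K) • (1 : Module.End K V)) x ∈
      (fun k : ℤ ↦ degreeSpace A k) ((0 : ℤ) + j) := by
    intro j x hx
    rw [zero_add]
    show (B - (l : K) • (1 : Module.End K V)) x ∈ degreeSpace A j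
    rw [mem_degreeSpace_iff] at hx ⊢
    rw [LinearMap.sub_apply, LinearMap.smul_apply, Module.End.one_apply, map_sub, map_smul, hx,
      ← Module.End.mul_apply, hAB, Module.End.mul_apply, hx, map_smul, smul_sub, smul_comm (l : K) (j : K) x]
  have h1 := coe_decompose_apply_add (fun k : ℤ ↦ degreeSpace A k) (B - (l : K) • (1 : Module.End K V)) (χ := 0)
    hdeg v k
  have hv0 : (B - (l : K) • (1 : Module.End K V)) v = 0 := by
    rw [LinearMap.sub_apply, LinearMap.smul_apply, Module.End.one_apply, mem_degreeSpace_iff.1 hv, sub_self]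
  rw [zero_add, hv0, DirectSum.decompose_zero, DirectSum.zero_apply, ZeroMemClass.coe_zero, eq_comm,
    LinearMap.sub_apply, sub_eq_zero, LinearMap.smul_apply, Module.End.one_apply] at h1
  exact mem_degreeSpace_iff.2 h1

omit [FiniteDimensional K V] in
/-- **Two commuting `ℤ`-diagonalisable operators are simultaneously diagonalisable**: `M = Σ_{(k,l)} M_k(A) ⊓ M_l(B)`.
[cite: LooijengaLunts1997, §5 (5.3) p. 21 L24–L28 ("the eigen spaces of the commuting pair (h_hor, h_ver) define a bigrading of M")] -/
theorem iSup_degreeSpace_inf_degreeSpace_eq_top_of_commute {A B : Module.End K V} (hA : IsZGrading A)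
    (hB : IsZGrading B) (hAB : A * B = B * A) :
    ⨆ p : ℤ × ℤ, degreeSpace A p.1 ⊓ degreeSpace B p.2 = ⊤ := by
  classical
  letI := hA.isInternal_degreeSpace.chooseDecomposition
  have hB' : ⨆ l : ℤ, degreeSpace B l = ⊤ := hB
  rw [eq_top_iff, ← hB']
  refine iSup_le fun l ↦ fun v hv ↦ ?_
  rw [← DirectSum.sum_support_decompose (fun k : ℤ ↦ degreeSpace A k) v]
  exact Submodule.sum_mem _ fun k _ ↦ Submodule.mem_iSup_of_mem (k, l)
    ⟨(DirectSum.decompose (fun k : ℤ ↦ degreeSpace A k) v k).2, coe_decompose_mem_degreeSpace_of_commute hAB hv k⟩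

omit [FiniteDimensional K V] in
/-- … and the joint eigenspaces `M_k(A) ⊓ M_l(B)` are INDEPENDENT (Mathlib's simultaneous generalised eigenspaces of a
commuting family, `Module.End.independent_iInf_maxGenEigenspace_of_forall_mapsTo`). [cite: LooijengaLunts1997, §5 (5.3) p. 21 L24–L28] -/
theorem iSupIndep_degreeSpace_inf_degreeSpace_of_commute {A B : Module.End K V} (hAB : A * B = B * A) :
    iSupIndep fun p : ℤ × ℤ ↦ degreeSpace A p.1 ⊓ degreeSpace B p.2 := by
  have hc : ∀ i j : Bool, Commute (cond j A B) (cond i A B) := by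
    intro i j
    cases i <;> cases j
    · exact Commute.refl _
    · exact hAB
    · exact hAB.symm
    · exact Commute.refl _
  have hind := Module.End.independent_iInf_maxGenEigenspace_of_forall_mapsTo (fun b : Bool ↦ cond b A B)
    (fun i j φ ↦ Module.End.mapsTo_maxGenEigenspace_of_comm (hc i j) φ)
  have hinj : Injective fun p : ℤ × ℤ ↦ fun b : Bool ↦ cond b (p.1 : K) (p.2 : K) := by
    intro p q hpq
    have h1 := congr_fun hpq true
    have h2 := congr_fun hpq false
    simp only [cond_true, cond_false, Int.cast_inj] at h1 h2
    exact Prod.ext h1 h2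
  refine (hind.comp hinj).mono fun p ↦ ?_
  show degreeSpace A p.1 ⊓ degreeSpace B p.2 ≤ ⨅ b : Bool, (cond b A B).maxGenEigenspace (cond b (p.1 : K) (p.2 : K))
  rw [iInf_bool_eq]
  exact inf_le_inf Module.End.eigenspace_le_maxGenEigenspace Module.End.eigenspace_le_maxGenEigenspace

omit [FiniteDimensional K V] in
/-- **The joint eigenspace decomposition** `M = ⊕_{(k,l) ∈ ℤ²} M_k(A) ⊓ M_l(B)` of two commuting `ℤ`-diagonalisable
operators. [cite: LooijengaLunts1997, §5 (5.3) p. 21 L24–L28] -/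
theorem isInternal_degreeSpace_inf_degreeSpace_of_commute {A B : Module.End K V} (hA : IsZGrading A)
    (hB : IsZGrading B) (hAB : A * B = B * A) :
    DirectSum.IsInternal fun p : ℤ × ℤ ↦ degreeSpace A p.1 ⊓ degreeSpace B p.2 :=
  DirectSum.isInternal_submodule_of_iSupIndep_of_iSup_eq_top (iSupIndep_degreeSpace_inf_degreeSpace_of_commute hAB)
    (iSup_degreeSpace_inf_degreeSpace_eq_top_of_commute hA hB hAB)

omit [CharZero K] [FiniteDimensional K V] in
/-- On the joint eigenspace `M_k(H) ⊓ M_n(h)` the operator `h_ver = h - H` is the scalar `n - k`.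
[cite: LooijengaLunts1997, §5 (5.3) p. 21 L24–L28] -/
theorem degreeSpace_inf_degreeSpace_le_degreeSpace_sub {h H : Module.End K V} (k n : ℤ) :
    degreeSpace H k ⊓ degreeSpace h n ≤ degreeSpace (h - H) (n - k) := by
  intro v hv
  obtain ⟨hk, hn⟩ := Submodule.mem_inf.1 hv
  rw [mem_degreeSpace_iff] at hk hn ⊢
  rw [LinearMap.sub_apply, hk, hn, ← sub_smul, Int.cast_sub]

omit [CharZero K] [FiniteDimensional K V] in
/-- Conversely `M_k(H) ⊓ M_l(h - H) ⊆ M_{k+l}(h)` ("`M_{k,l}` gets identified with `Gr^k_hor M_{k+l}`": bidegree `(k, l)` has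
total degree `k + l`). [cite: LooijengaLunts1997, §5 (5.3) p. 21 L36–L37] -/
theorem degreeSpace_inf_degreeSpace_sub_le_degreeSpace {h H : Module.End K V} (k l : ℤ) :
    degreeSpace H k ⊓ degreeSpace (h - H) l ≤ degreeSpace h (k + l) := by
  intro v hv
  obtain ⟨hk, hl⟩ := Submodule.mem_inf.1 hv
  rw [mem_degreeSpace_iff] at hk hl ⊢
  rw [LinearMap.sub_apply, hk, sub_eq_iff_eq_add] at hl
  rw [hl, ← add_smul, Int.cast_add, add_comm]

omit [FiniteDimensional K V] in
/-- **"`h_ver` … semisimple … integral eigen values"**: for commuting `ℤ`-diagonalisable `h`, `H`, the difference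
`h_ver = h - H` is `ℤ`-diagonalisable. [cite: LooijengaLunts1997, §5 (5.3) p. 21 L32–L36] -/
theorem isZGrading_sub_of_commute {h H : Module.End K V} (hgr : IsZGrading h) (hH : IsZGrading H)
    (hhH : h * H = H * h) : IsZGrading (h - H) := by
  rw [IsZGrading, eq_top_iff, ← iSup_degreeSpace_inf_degreeSpace_eq_top_of_commute hH hgr hhH.symm]
  exact iSup_le fun p ↦ (degreeSpace_inf_degreeSpace_le_degreeSpace_sub p.1 p.2).trans
    (le_iSup (fun l : ℤ ↦ degreeSpace (h - H) l) (p.2 - p.1))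

/-- **THE BIGRADING of (5.3)**: for a `ℤ`-graded `(M, h)` and an `𝔰𝔩₂`-triple `(e, H, F)` of `𝔤𝔩(M)` with `hH = Hh`
("`h_hor` of total degree `0`"), the joint eigenspaces `M_{k,l} = M_k(h_hor) ⊓ M_l(h_ver)`, `h_hor = H`, `h_ver = h - H`,
form an internal direct sum decomposition `M = ⊕_{(k,l) ∈ ℤ²} M_{k,l}` — "the eigen spaces of the commuting pair
`(h_hor, h_ver)` define a bigrading of `M`". [cite: LooijengaLunts1997, §5 (5.3) p. 21 L24–L28, Proposition L32–L37] -/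
theorem isInternal_bidegreeSpace {h H e F : Module.End K V} (hgr : IsZGrading h) (hH0 : H ≠ 0)
    (h1 : H * e - e * H = (2 : K) • e) (h2 : H * F - F * H = -((2 : K) • F)) (h3 : e * F - F * e = H)
    (hhH : h * H = H * h) :
    DirectSum.IsInternal fun p : ℤ × ℤ ↦ degreeSpace H p.1 ⊓ degreeSpace (h - H) p.2 :=
  have hH : IsZGrading H := isZGrading_h_of_sl2Triple hH0 h1 h2 h3
  isInternal_degreeSpace_inf_degreeSpace_of_commute hH (isZGrading_sub_of_commute hgr hH hhH)
    (sub_mul_comm_of_commute hhH).symm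

omit [FiniteDimensional K V] in
/-- **`M_n = ⊕_k M_{k, n-k}`** — the bigrading refines the grading ("for the resulting bigrading of `M`, `M_{k,l}` gets
identified with `Gr^k_hor M_{k+l}`"): `degreeSpace h n = ⨆_k degreeSpace H k ⊓ degreeSpace (h - H) (n - k)` for
a `ℤ`-diagonalisable `H` commuting with `h`. [cite: LooijengaLunts1997, §5 (5.3) Proposition, p. 21 L32–L37] -/
theorem degreeSpace_eq_iSup_bidegreeSpace {h H : Module.End K V} (hH : IsZGrading H) (hhH : h * H = H * h) (n : ℤ) :
    degreeSpace h n = ⨆ k : ℤ, degreeSpace H k ⊓ degreeSpace (h - H) (n - k) := by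
  classical
  refine le_antisymm (fun v hv ↦ ?_) (iSup_le fun k ↦ ?_)
  · letI := hH.isInternal_degreeSpace.chooseDecomposition
    rw [← DirectSum.sum_support_decompose (fun k : ℤ ↦ degreeSpace H k) v]
    refine Submodule.sum_mem _ fun k _ ↦ Submodule.mem_iSup_of_mem k ?_
    have hk : (DirectSum.decompose (fun k : ℤ ↦ degreeSpace H k) v k : V) ∈ degreeSpace h n :=
      coe_decompose_mem_degreeSpace_of_commute hhH.symm hv k
    exact ⟨(DirectSum.decompose (fun k : ℤ ↦ degreeSpace H k) v k).2,
      degreeSpace_inf_degreeSpace_le_degreeSpace_sub k n ⟨(DirectSum.decompose (fun k : ℤ ↦ degreeSpace H k) v k).2, hk⟩⟩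
  · have h1 := degreeSpace_inf_degreeSpace_sub_le_degreeSpace (h := h) (H := H) k (n - k)
    rwa [add_sub_cancel] at h1

/-! ### §3 The horizontal filtration `hor^k M = ⊕_{j ≥ k} M_j(h_hor)` -/

omit [CharZero K] [FiniteDimensional K V] in
/-- `e` raises the horizontal filtration by `2`: `e (hor^k M) ⊆ hor^{k+2} M` (`He - eH = 2e`; "`e_a (hor^k M) ⊂ hor^{k+2} M`").
[cite: LooijengaLunts1997, §5 (5.3) p. 21 L11–L13] -/
theorem map_e_horFiltration_le {H e : Module.End K V} (h1 : H * e - e * H = (2 : K) • e) (k : ℤ) :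
    (⨆ (j : ℤ) (_ : k ≤ j), degreeSpace H j).map e ≤ ⨆ (j : ℤ) (_ : k + 2 ≤ j), degreeSpace H j := by
  rw [Submodule.map_iSup]
  refine iSup_le fun j ↦ ?_
  rw [Submodule.map_iSup]
  refine iSup_le fun hj ↦ (Submodule.map_le_iff_le_comap.2 fun x hx ↦ ?_)
  exact Submodule.mem_iSup_of_mem (j + 2) (Submodule.mem_iSup_of_mem (by omega)
    (mapsTo_degreeSpace_of_commutator_eq_two_smul h1 j hx))

omit [CharZero K] [FiniteDimensional K V] in
/-- **"So `f_a` will map `hor^k M_r` to `hor^{k-2} M_{r-2}`"**: `F (hor^k M) ⊆ hor^{k-2} M` (`HF - FH = -2F`).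
[cite: LooijengaLunts1997, §5 (5.3) p. 21 L19–L21] -/
theorem map_f_horFiltration_le {H F : Module.End K V} (h2 : H * F - F * H = -((2 : K) • F)) (k : ℤ) :
    (⨆ (j : ℤ) (_ : k ≤ j), degreeSpace H j).map F ≤ ⨆ (j : ℤ) (_ : k - 2 ≤ j), degreeSpace H j := by
  rw [Submodule.map_iSup]
  refine iSup_le fun j ↦ ?_
  rw [Submodule.map_iSup]
  refine iSup_le fun hj ↦ (Submodule.map_le_iff_le_comap.2 fun x hx ↦ ?_)
  exact Submodule.mem_iSup_of_mem (j - 2) (Submodule.mem_iSup_of_mem (by omega)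
    (mapsTo_degreeSpace_of_commutator_eq_neg_two_smul h2 j hx))

omit [CharZero K] [FiniteDimensional K V] in
/-- An operator commuting with `H` — e.g. `h_ver = h - H`, or `h` — preserves every `M_j(H)`, hence the horizontal
filtration ("`h_hor` … has this property"/"`h_ver`"). [cite: LooijengaLunts1997, §5 (5.3) p. 21 L21–L26] -/
theorem map_horFiltration_le_of_commute {H T : Module.End K V} (hHT : H * T = T * H) (k : ℤ) :
    (⨆ (j : ℤ) (_ : k ≤ j), degreeSpace H j).map T ≤ ⨆ (j : ℤ) (_ : k ≤ j), degreeSpace H j := by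
  rw [Submodule.map_iSup]
  refine iSup_le fun j ↦ ?_
  rw [Submodule.map_iSup]
  refine iSup_le fun hj ↦ (Submodule.map_le_iff_le_comap.2 fun x hx ↦ ?_)
  refine Submodule.mem_iSup_of_mem j (Submodule.mem_iSup_of_mem hj ?_)
  rw [mem_degreeSpace_iff] at hx
  show T x ∈ degreeSpace H j
  rw [mem_degreeSpace_iff, ← Module.End.mul_apply, hHT, Module.End.mul_apply, hx, map_smul]

omit [CharZero K] [FiniteDimensional K V] in
/-- **"It is clear that the eigen spaces of `h_hor` split the horizontal filtration"**, first half: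
`hor^k M = M_k(H) + hor^{k+1} M`. [cite: LooijengaLunts1997, §5 (5.3) p. 21 L23–L24; (5.1) p. 20 L103–L105 ("the k-eigen space of h is a supplement of W^{k+1} in W^k")] -/
theorem horFiltration_eq_sup {H : Module.End K V} (k : ℤ) :
    ⨆ (j : ℤ) (_ : k ≤ j), degreeSpace H j = degreeSpace H k ⊔ ⨆ (j : ℤ) (_ : k + 1 ≤ j), degreeSpace H j := by
  refine le_antisymm (iSup_le fun j ↦ iSup_le fun hj ↦ ?_) (sup_le ?_ (iSup_le fun j ↦ iSup_le fun hj ↦ ?_))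
  · rcases eq_or_lt_of_le hj with rfl | hlt
    · exact le_sup_left
    · exact le_sup_of_le_right (le_iSup₂_of_le j (by omega) le_rfl)
  · exact le_iSup₂_of_le k le_rfl le_rfl
  · exact le_iSup₂_of_le j (by omega) le_rfl

omit [FiniteDimensional K V] in
/-- … second half: `M_k(H) ∩ hor^{k+1} M = 0` (the eigenspaces of `H` are independent), so
`hor^k M = M_k(H) ⊕ hor^{k+1} M`. [cite: LooijengaLunts1997, §5 (5.3) p. 21 L23–L24; (5.1) p. 20 L103–L105] -/
theorem disjoint_degreeSpace_horFiltration {H : Module.End K V} (k : ℤ) :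
    Disjoint (degreeSpace H k) (⨆ (j : ℤ) (_ : k + 1 ≤ j), degreeSpace H j) := by
  have h1 := (iSupIndep_def.1 (H.eigenspaces_iSupIndep.comp (f := fun k : ℤ ↦ (k : K)) Int.cast_injective)) k
  refine h1.mono_right (iSup₂_le fun j hj ↦ ?_)
  exact le_iSup₂_of_le j (show j ≠ k by omega) le_rfl

/-- **"It is then immediate that the horizontal filtration is the Lefschetz filtration of the transformation `e_a` in
`M`"**: for an `𝔰𝔩₂`-triple `(e, H, F)` of `𝔤𝔩(M)` the increasing reindexing `W_i = hor^{-i} M = ⊕_{j ≤ i} M_{-j}(H)` of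
the horizontal filtration IS the monodromy weight ("Lefschetz") filtration of `e` centred at `0` (`e W_i ⊆ W_{i-2}`,
`e^ℓ : Gr_ℓ ⥲ Gr_{-ℓ}`; the tree's `IsSl2Triple.isMonodromyWeightFiltration_biSup_eigenspace_neg`, Cattani et al. (A.3.4)),
unique by the tree's `IsMonodromyWeightFiltration.unique`. [cite: LooijengaLunts1997, §5 (5.3) p. 21 L15–L17, (5.1) p. 20 L99–L106] [cite: CattaniElZeinGriffithsLe2014, App. A Prop. A.2.2, (A.3.4)] -/
theorem isMonodromyWeightFiltration_horFiltration {H e F : Module.End K V} (hH0 : H ≠ 0)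
    (h1 : H * e - e * H = (2 : K) • e) (h2 : H * F - F * H = -((2 : K) • F)) (h3 : e * F - F * e = H) :
    IsMonodromyWeightFiltration e 0 (fun i ↦ ⨆ (j : ℤ) (_ : j ≤ i), degreeSpace H (-j)) := by
  letI : LieRing (Module.End K V) := LieRing.ofAssociativeRing
  letI : LieAlgebra K (Module.End K V) := LieAlgebra.ofAssociativeAlgebra
  have t : IsSl2Triple H e F :=
    { h_ne_zero := hH0
      lie_e_f := h3
      lie_h_e_nsmul := by rw [← ofNat_smul_eq_nsmul K 2 e]; exact h1
      lie_h_f_nsmul := by rw [← ofNat_smul_eq_nsmul K 2 F]; exact h2 }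
  have hW := Literature.AlgebraicGeometry.HodgeTheory.IsSl2Triple.isMonodromyWeightFiltration_biSup_eigenspace_neg
    (k := K) (M := V) t 0
  simp only [LieModule.toEnd_module_end, LieHom.id_apply, sub_zero] at hW
  have heq : (fun i : ℤ ↦ ⨆ (j : ℤ) (_ : j ≤ i), degreeSpace H (-j)) =
      fun i : ℤ ↦ ⨆ (j : ℤ) (_ : j ≤ i), Module.End.eigenspace H (-(j : K)) := by
    funext i
    simp only [degreeSpace, Int.cast_neg]
  rw [heq]
  exact hW

/-! ### §4 The horizontal filtration is graded; the vertical filtration; `M_{k,l} ≅ Gr^k_hor M_{k+l}` -/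

omit [CharZero K] [FiniteDimensional K V] in
/-- Support of components: an element of `⊕_{j ∈ S} M_j(A)` has vanishing components outside `S` (uniqueness of the
decomposition `M = ⊕_j M_j(A)`). [cite: LooijengaLunts1997, §5 (5.3) p. 21 L1–L4 ("hor^k M = ⊕_l hor^k M_l")] -/
theorem coe_decompose_eq_zero_of_mem_biSup {A : Module.End K V} [DirectSum.Decomposition fun k : ℤ ↦ degreeSpace A k]
    {S : Set ℤ} {v : V} (hv : v ∈ ⨆ (j : ℤ) (_ : j ∈ S), degreeSpace A j) {i : ℤ} (hi : i ∉ S) :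
    (DirectSum.decompose (fun k : ℤ ↦ degreeSpace A k) v i : V) = 0 := by
  classical
  -- the set of elements whose `i`-component vanishes is a submodule containing every `M_j(A)`, `j ∈ S`
  let P : Submodule K V :=
    { carrier := {v | (DirectSum.decompose (fun k : ℤ ↦ degreeSpace A k) v i : V) = 0}
      add_mem' := fun {a b} ha hb ↦ by
        simp only [Set.mem_setOf_eq] at ha hb ⊢
        rw [DirectSum.decompose_add, DirectSum.add_apply, Submodule.coe_add, ha, hb, add_zero]
      zero_mem' := by
        simp only [Set.mem_setOf_eq]
        rw [DirectSum.decompose_zero, DirectSum.zero_apply, ZeroMemClass.coe_zero]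
      smul_mem' := fun c a ha ↦ by
        simp only [Set.mem_setOf_eq] at ha ⊢
        rw [DirectSum.decompose_smul, DirectSum.smul_apply, Submodule.coe_smul, ha, smul_zero] }
  have hP : (⨆ (j : ℤ) (_ : j ∈ S), degreeSpace A j) ≤ P :=
    iSup₂_le fun j hj x hx ↦ DirectSum.decompose_of_mem_ne (fun k : ℤ ↦ degreeSpace A k) hx
      (fun h ↦ hi (h ▸ hj))
  exact hP hv

omit [FiniteDimensional K V] in
/-- **"`hor^k M = ⊕_l hor^k M_l`" — the horizontal filtration is compatible with the grading**: for a `ℤ`-diagonalisable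
`H` commuting with `h`, `hor^k M ∩ M_n = ⊕_{j ≥ k} M_j(H) ∩ M_{n-j}(h - H)` (`= ⊕_{j ≥ k} M_{j, n-j}`).
[cite: LooijengaLunts1997, §5 (5.3) p. 21 L1–L4, L36–L37] -/
theorem horFiltration_inf_degreeSpace_eq {h H : Module.End K V} (hH : IsZGrading H) (hhH : h * H = H * h) (k n : ℤ) :
    (⨆ (j : ℤ) (_ : k ≤ j), degreeSpace H j) ⊓ degreeSpace h n =
      ⨆ (j : ℤ) (_ : k ≤ j), degreeSpace H j ⊓ degreeSpace (h - H) (n - j) := by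
  classical
  refine le_antisymm (fun v hv ↦ ?_) (iSup₂_le fun j hj ↦ le_inf ?_ ?_)
  · obtain ⟨hv1, hv2⟩ := Submodule.mem_inf.1 hv
    letI := hH.isInternal_degreeSpace.chooseDecomposition
    rw [← DirectSum.sum_support_decompose (fun k : ℤ ↦ degreeSpace H k) v]
    refine Submodule.sum_mem _ fun j _ ↦ ?_
    by_cases hj : k ≤ j
    · refine Submodule.mem_iSup_of_mem j (Submodule.mem_iSup_of_mem hj ?_)
      have hjn : (DirectSum.decompose (fun k : ℤ ↦ degreeSpace H k) v j : V) ∈ degreeSpace h n :=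
        coe_decompose_mem_degreeSpace_of_commute hhH.symm hv2 j
      exact ⟨(DirectSum.decompose (fun k : ℤ ↦ degreeSpace H k) v j).2,
        degreeSpace_inf_degreeSpace_le_degreeSpace_sub j n
          ⟨(DirectSum.decompose (fun k : ℤ ↦ degreeSpace H k) v j).2, hjn⟩⟩
    · rw [coe_decompose_eq_zero_of_mem_biSup (S := {j | k ≤ j}) hv1 hj]
      exact Submodule.zero_mem _
  · exact inf_le_left.trans (le_iSup₂_of_le j hj le_rfl)
  · have h1 := degreeSpace_inf_degreeSpace_sub_le_degreeSpace (h := h) (H := H) j (n - j)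
    rwa [add_sub_cancel] at h1

omit [FiniteDimensional K V] in
/-- **"`M_{k,l}` gets identified with `Gr^k_hor M_{k+l}`"**: inside `M_n`, the bidegree-`(k, n-k)` piece is a COMPLEMENT
of `hor^{k+1} M ∩ M_n` in `hor^k M ∩ M_n` — `hor^k ∩ M_n = M_{k,n-k} ⊕ (hor^{k+1} ∩ M_n)`.
[cite: LooijengaLunts1997, §5 (5.3) Proposition, p. 21 L36–L37; (5.1) p. 20 L103–L105] -/
theorem horFiltration_inf_degreeSpace_eq_sup {h H : Module.End K V} (hH : IsZGrading H) (hhH : h * H = H * h)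
    (k n : ℤ) :
    (⨆ (j : ℤ) (_ : k ≤ j), degreeSpace H j) ⊓ degreeSpace h n =
      (degreeSpace H k ⊓ degreeSpace (h - H) (n - k)) ⊔ ((⨆ (j : ℤ) (_ : k + 1 ≤ j), degreeSpace H j) ⊓ degreeSpace h n) := by
  rw [horFiltration_inf_degreeSpace_eq hH hhH k n, horFiltration_inf_degreeSpace_eq hH hhH (k + 1) n]
  refine le_antisymm (iSup₂_le fun j hj ↦ ?_) (sup_le (le_iSup₂_of_le k le_rfl le_rfl) (iSup₂_le fun j hj ↦ ?_))
  · rcases eq_or_lt_of_le hj with rfl | hlt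
    · exact le_sup_left
    · exact le_sup_of_le_right (le_iSup₂_of_le j (by omega) le_rfl)
  · exact le_iSup₂_of_le j (by omega) le_rfl

omit [FiniteDimensional K V] in
/-- … and the two pieces are disjoint (`M_{k,n-k} ⊆ M_k(H)`, `hor^{k+1} M ∩ M_n ⊆ hor^{k+1} M`, A1-148
`disjoint_degreeSpace_horFiltration`). [cite: LooijengaLunts1997, §5 (5.3) Proposition, p. 21 L36–L37] -/
theorem disjoint_bidegreeSpace_horFiltration_inf {h H : Module.End K V} (k n : ℤ) :
    Disjoint (degreeSpace H k ⊓ degreeSpace (h - H) (n - k))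
      ((⨆ (j : ℤ) (_ : k + 1 ≤ j), degreeSpace H j) ⊓ degreeSpace h n) :=
  (disjoint_degreeSpace_horFiltration (H := H) k).mono inf_le_left inf_le_left

omit [FiniteDimensional K V] in
/-- Every `M_m(B)` is the sum of its joint pieces with a commuting `ℤ`-diagonalisable `A`: `M_m(B) = ⊕_j M_j(A) ∩ M_m(B)`.
[cite: LooijengaLunts1997, §5 (5.3) p. 21 L24–L28] -/
theorem degreeSpace_eq_iSup_inf_of_commute {A B : Module.End K V} (hA : IsZGrading A) (hAB : A * B = B * A) (m : ℤ) :
    degreeSpace B m = ⨆ j : ℤ, degreeSpace A j ⊓ degreeSpace B m := by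
  classical
  refine le_antisymm (fun v hv ↦ ?_) (iSup_le fun j ↦ inf_le_right)
  letI := hA.isInternal_degreeSpace.chooseDecomposition
  rw [← DirectSum.sum_support_decompose (fun k : ℤ ↦ degreeSpace A k) v]
  exact Submodule.sum_mem _ fun j _ ↦ Submodule.mem_iSup_of_mem j
    ⟨(DirectSum.decompose (fun k : ℤ ↦ degreeSpace A k) v j).2, coe_decompose_mem_degreeSpace_of_commute hAB hv j⟩

omit [FiniteDimensional K V] in
/-- **The vertical filtration** "`ver_k M := Σ_r hor^{r-k} M_r`" IS `⊕_{m ≤ k} M_m(h_ver)` ("we call the corresponding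
grading of `Gr_ver M` the vertical grading"): for a `ℤ`-diagonalisable `H` commuting with `h`,
`⨆_r (hor^{r-k} M ∩ M_r) = ⨆_{m ≤ k} M_m(h - H)`. [cite: LooijengaLunts1997, §5 (5.3) p. 21 L4–L9] -/
theorem verFiltration_eq {h H : Module.End K V} (hH : IsZGrading H) (hhH : h * H = H * h) (k : ℤ) :
    ⨆ r : ℤ, (⨆ (j : ℤ) (_ : r - k ≤ j), degreeSpace H j) ⊓ degreeSpace h r =
      ⨆ (m : ℤ) (_ : m ≤ k), degreeSpace (h - H) m := by
  refine le_antisymm (iSup_le fun r ↦ ?_) (iSup₂_le fun m hm ↦ ?_)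
  · rw [horFiltration_inf_degreeSpace_eq hH hhH]
    exact iSup₂_le fun j hj ↦ inf_le_right.trans (le_iSup₂_of_le (r - j) (by omega) le_rfl)
  · rw [degreeSpace_eq_iSup_inf_of_commute hH (A := H) (B := h - H)
      (sub_mul_comm_of_commute hhH).symm m]
    refine iSup_le fun j ↦ le_iSup_of_le (j + m) ?_
    rw [horFiltration_inf_degreeSpace_eq hH hhH]
    refine le_iSup₂_of_le j (by omega) (le_inf inf_le_left ?_)
    rw [show j + m - j = m by omega]
    exact inf_le_right

omit [CharZero K] [FiniteDimensional K V] in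
/-- **"This shows that `f_a` preserves the vertical filtration. It also follows that `h_hor = [e_a, f_a]` has this
property"** — indeed every operator commuting with `h_ver = h - H` (such as `F`, `H`, `e`, by `sub_mul_comm_of_…`)
preserves each `M_m(h_ver)`, hence `ver_k M = ⊕_{m ≤ k} M_m(h_ver)`. [cite: LooijengaLunts1997, §5 (5.3) p. 21 L19–L23] -/
theorem map_verFiltration_le_of_commute {h H T : Module.End K V} (hT : (h - H) * T = T * (h - H)) (k : ℤ) :
    (⨆ (m : ℤ) (_ : m ≤ k), degreeSpace (h - H) m).map T ≤ ⨆ (m : ℤ) (_ : m ≤ k), degreeSpace (h - H) m := by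
  rw [Submodule.map_iSup]
  refine iSup_le fun m ↦ ?_
  rw [Submodule.map_iSup]
  refine iSup_le fun hm ↦ (Submodule.map_le_iff_le_comap.2 fun x hx ↦ ?_)
  refine Submodule.mem_iSup_of_mem m (Submodule.mem_iSup_of_mem hm ?_)
  rw [mem_degreeSpace_iff] at hx
  show T x ∈ degreeSpace (h - H) m
  rw [mem_degreeSpace_iff, ← Module.End.mul_apply, hT, Module.End.mul_apply, hx, map_smul]

/-! ### §5 "The eigen spaces of `(h_hor, h_ver)` under the adjoint representation also define a bigrading" of `𝔤𝔩(M)` -/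

omit [CharZero K] [FiniteDimensional K V] in
/-- Degree `k` for `ad H = (X ↦ HX - XH)` on `𝔤𝔩(M)`, spelled out: `X ∈ 𝔤𝔩(M)_k(ad H) ↔ HX - XH = kX` ("`𝔤𝔩(M)_{2k}` is
the set of `u ∈ 𝔤𝔩(M)` that map `M_{l}` to `M_{l+2k}`", graded by `ad h`). [cite: LooijengaLunts1997, §1 (1.1) p. 4 L56–L58] -/
theorem mem_degreeSpace_mulLeft_sub_mulRight_iff {H X : Module.End K V} {k : ℤ} :
    X ∈ degreeSpace (LinearMap.mulLeft K H - LinearMap.mulRight K H) k ↔ H * X - X * H = (k : K) • X := by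
  rw [mem_degreeSpace_iff]
  rfl

/-- **`𝔤𝔩(M)` is `ℤ`-graded by `ad H` for a `ℤ`-diagonalisable `H`**: the elementary endomorphisms of an eigenbasis
of `H` are `ad H`-eigenvectors with eigenvalues the differences of degrees (Mathlib `Module.Basis.end`,
`Module.Basis.lie_end_of_apply_eq_smul`; cf. A1-146 `iSup_eigenspace_mulLeft_sub_mulRight_eq_top`).
[cite: LooijengaLunts1997, §1 (1.1) p. 4 L56–L58 ("𝔤𝔩(M) … graded by ad h"); §5 (5.3) p. 21 L28–L30] -/
theorem IsZGrading.mulLeft_sub_mulRight {H : Module.End K V} (hH : IsZGrading H) :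
    IsZGrading (LinearMap.mulLeft K H - LinearMap.mulRight K H) := by
  classical
  have hint := hH.isInternal_degreeSpace
  let I := (k : ℤ) × Fin (finrank K (degreeSpace H k))
  let v : Module.Basis I K V := hint.collectedBasis fun k ↦ Module.finBasis K (degreeSpace H k)
  haveI : Fintype I := FiniteDimensional.fintypeBasisIndex v
  have hsv : ∀ i : I, H (v i) = (fun i : I ↦ ((i.1 : ℤ) : K)) i • v i := fun i ↦
    mem_degreeSpace_iff.1 (hint.collectedBasis_mem _ i)
  rw [IsZGrading, eq_top_iff, ← v.end.span_eq, Submodule.span_le]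
  rintro _ ⟨⟨i, j⟩, rfl⟩
  refine Submodule.mem_iSup_of_mem (i.1 - j.1) ?_
  rw [mem_degreeSpace_mulLeft_sub_mulRight_iff, Int.cast_sub]
  have h1 := v.lie_end_of_apply_eq_smul (fun i : I ↦ ((i.1 : ℤ) : K)) H hsv i j
  rwa [Ring.lie_def] at h1

omit [CharZero K] [FiniteDimensional K V] in
/-- `ad H` and `ad W` commute on `𝔤𝔩(M)` when `H` and `W` commute (`[ad H, ad W] = ad [H, W] = 0`; "the commuting
pair `(h_hor, h_ver)` … under the adjoint representation"). [cite: LooijengaLunts1997, §5 (5.3) p. 21 L24–L30] -/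
theorem mulLeft_sub_mulRight_mul_comm {H W : Module.End K V} (hc : H * W = W * H) :
    (LinearMap.mulLeft K H - LinearMap.mulRight K H) * (LinearMap.mulLeft K W - LinearMap.mulRight K W) =
      (LinearMap.mulLeft K W - LinearMap.mulRight K W) * (LinearMap.mulLeft K H - LinearMap.mulRight K H) := by
  refine LinearMap.ext fun X ↦ ?_
  simp only [Module.End.mul_apply, LinearMap.sub_apply, LinearMap.mulLeft_apply, LinearMap.mulRight_apply, mul_sub,
    sub_mul, ← mul_assoc, hc]
  rw [mul_assoc X H W, hc, ← mul_assoc]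
  abel

/-- **The adjoint bigrading of `𝔤𝔩(M)`**: for commuting `ℤ`-diagonalisable `H = h_hor`, `W = h_ver`,
`𝔤𝔩(M) = ⊕_{(k,l)} 𝔤𝔩(M)_{k,l}` with `𝔤𝔩(M)_{k,l} = {X : HX - XH = kX, WX - XW = lX}` (§2
`isInternal_degreeSpace_inf_degreeSpace_of_commute` for `(ad H, ad W)`). [cite: LooijengaLunts1997, §5 (5.3) p. 21 L28–L30
("The eigen spaces of (h_hor, h_ver) under the adjoint representation also define a bigrading")] -/
theorem isInternal_degreeSpace_mulLeft_sub_mulRight {H W : Module.End K V} (hH : IsZGrading H) (hW : IsZGrading W)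
    (hc : H * W = W * H) :
    DirectSum.IsInternal fun p : ℤ × ℤ ↦ degreeSpace (LinearMap.mulLeft K H - LinearMap.mulRight K H) p.1 ⊓
      degreeSpace (LinearMap.mulLeft K W - LinearMap.mulRight K W) p.2 :=
  isInternal_degreeSpace_inf_degreeSpace_of_commute hH.mulLeft_sub_mulRight hW.mulLeft_sub_mulRight
    (mulLeft_sub_mulRight_mul_comm hc)

omit [CharZero K] [FiniteDimensional K V] in
/-- An operator of `ad H`-degree `k` maps `M_i(H)` to `M_{i+k}(H)`. [cite: LooijengaLunts1997, §1 (1.1) p. 4 L56–L58] -/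
theorem apply_mem_degreeSpace_of_mem_degreeSpace_mulLeft_sub_mulRight {H X : Module.End K V} {k i : ℤ}
    (hX : X ∈ degreeSpace (LinearMap.mulLeft K H - LinearMap.mulRight K H) k) {v : V} (hv : v ∈ degreeSpace H i) :
    X v ∈ degreeSpace H (i + k) := by
  rw [mem_degreeSpace_mulLeft_sub_mulRight_iff, sub_eq_iff_eq_add] at hX
  rw [mem_degreeSpace_iff] at hv ⊢
  rw [← Module.End.mul_apply, hX, LinearMap.add_apply, LinearMap.smul_apply, Module.End.mul_apply, hv, map_smul,
    Int.cast_add, add_smul, add_comm]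

omit [CharZero K] [FiniteDimensional K V] in
/-- An operator of adjoint bidegree `(k, l)` maps `M_{i,j} = M_i(H) ⊓ M_j(W)` to `M_{i+k, j+l}`.
[cite: LooijengaLunts1997, §5 (5.3) p. 21 L28–L30, L38–L40 ("𝔞_{2,0} … has the Lefschetz property in M with respect to the horizontal grading")] -/
theorem apply_mem_bidegreeSpace_of_mem {H W X : Module.End K V} {k l i j : ℤ}
    (hXH : X ∈ degreeSpace (LinearMap.mulLeft K H - LinearMap.mulRight K H) k)
    (hXW : X ∈ degreeSpace (LinearMap.mulLeft K W - LinearMap.mulRight K W) l) {v : V}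
    (hv : v ∈ degreeSpace H i ⊓ degreeSpace W j) :
    X v ∈ degreeSpace H (i + k) ⊓ degreeSpace W (j + l) :=
  ⟨apply_mem_degreeSpace_of_mem_degreeSpace_mulLeft_sub_mulRight hXH hv.1,
    apply_mem_degreeSpace_of_mem_degreeSpace_mulLeft_sub_mulRight hXW hv.2⟩

/-! ### §6 Invariant subspaces are (bi)graded: "… also define a bigrading of `𝔤(𝔞, M)`" -/

omit [CharZero K] in
/-- **The eigenspaces of a `ℤ`-diagonalisable operator split every invariant subspace**: if `A U ⊆ U` then
`U = ⊕_k U ∩ M_k(A)` (Mathlib `Submodule.inf_iSup_genEigenspace`: the components of `u ∈ U` are polynomials in `A`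
applied to `u`; non-integral eigenvalues do not occur, the tree's `eigenspace_eq_bot_of_forall_ne`, `LefschetzModulePrimitive.lean`). [cite: LooijengaLunts1997, §5 (5.3) p. 21 L23–L24 ("the eigen spaces of h_hor split the horizontal filtration"), L28–L30] -/
theorem eq_iSup_inf_degreeSpace_of_forall_mem {A : Module.End K V} (hA : IsZGrading A) {U : Submodule K V}
    (hU : ∀ x ∈ U, A x ∈ U) : U = ⨆ k : ℤ, U ⊓ degreeSpace A k := by
  refine le_antisymm ?_ (iSup_le fun k ↦ inf_le_left)
  have htop : ⨆ μ : K, A.genEigenspace μ 1 = ⊤ := by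
    rw [eq_top_iff, ← (show ⨆ k : ℤ, degreeSpace A k = ⊤ from hA)]
    exact iSup_le fun k ↦ le_iSup (fun μ : K ↦ A.genEigenspace μ 1) (k : K)
  have h1 := Submodule.inf_iSup_genEigenspace hU 1
  rw [htop, inf_top_eq] at h1
  refine h1.le.trans (iSup_le fun μ ↦ ?_)
  by_cases hμ : ∃ k : ℤ, (k : K) = μ
  · obtain ⟨k, rfl⟩ := hμ
    exact le_iSup (fun k : ℤ ↦ U ⊓ degreeSpace A k) k
  · have h2 : A.genEigenspace μ 1 = ⊥ := eigenspace_eq_bot_of_forall_ne hA fun k hk ↦ hμ ⟨k, hk⟩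
    rw [h2, inf_bot_eq]
    exact bot_le

omit [CharZero K] [FiniteDimensional K V] in
/-- An operator commuting with `A` preserves each `M_k(A)`. [folklore] -/
private theorem apply_mem_degreeSpace_of_commute {A B : Module.End K V} (hAB : A * B = B * A) {k : ℤ} {x : V}
    (hx : x ∈ degreeSpace A k) : B x ∈ degreeSpace A k := by
  rw [mem_degreeSpace_iff] at hx ⊢
  rw [← Module.End.mul_apply, hAB, Module.End.mul_apply, hx, map_smul]

omit [CharZero K] in
/-- **… so a subspace invariant under two commuting `ℤ`-diagonalisable operators is bigraded**:
`U = ⊕_{(k,l)} U ∩ M_k(A) ∩ M_l(B)` — in (5.3) with `(A, B) = (ad h_hor, ad h_ver)` on `𝔤𝔩(M)` and `U = 𝔤(𝔞, M)`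
(which contains `h_hor`, `h_ver`, hence is `ad`-stable): "the eigen spaces of `(h_hor, h_ver)` under the adjoint
representation also define a bigrading of `𝔤(𝔞, M)`". [cite: LooijengaLunts1997, §5 (5.3) p. 21 L28–L30] -/
theorem eq_iSup_inf_bidegreeSpace_of_forall_mem {A B : Module.End K V} (hA : IsZGrading A) (hB : IsZGrading B)
    (hAB : A * B = B * A) {U : Submodule K V} (hUA : ∀ x ∈ U, A x ∈ U) (hUB : ∀ x ∈ U, B x ∈ U) :
    U = ⨆ p : ℤ × ℤ, U ⊓ (degreeSpace A p.1 ⊓ degreeSpace B p.2) := by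
  refine le_antisymm ?_ (iSup_le fun p ↦ inf_le_left)
  calc U = ⨆ k : ℤ, U ⊓ degreeSpace A k := eq_iSup_inf_degreeSpace_of_forall_mem hA hUA
    _ ≤ _ := iSup_le fun k ↦ ?_
  have hk : ∀ x ∈ U ⊓ degreeSpace A k, B x ∈ U ⊓ degreeSpace A k := fun x hx ↦
    ⟨hUB x hx.1, apply_mem_degreeSpace_of_commute hAB hx.2⟩
  calc U ⊓ degreeSpace A k = ⨆ l : ℤ, U ⊓ degreeSpace A k ⊓ degreeSpace B l :=
        eq_iSup_inf_degreeSpace_of_forall_mem hB hk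
    _ ≤ _ := iSup_le fun l ↦ le_iSup_of_le (k, l) (by rw [inf_assoc])

omit [FiniteDimensional K V] in
/-- The pieces `U ∩ M_k(A) ∩ M_l(B)` are independent. [cite: LooijengaLunts1997, §5 (5.3) p. 21 L28–L30] -/
theorem iSupIndep_inf_bidegreeSpace {A B : Module.End K V} (hAB : A * B = B * A) (U : Submodule K V) :
    iSupIndep fun p : ℤ × ℤ ↦ U ⊓ (degreeSpace A p.1 ⊓ degreeSpace B p.2) :=
  (iSupIndep_degreeSpace_inf_degreeSpace_of_commute hAB).mono fun _ ↦ inf_le_right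

omit [CharZero K] [FiniteDimensional K V] in
/-- Independence of submodules of `↥U` can be tested in `M`. [folklore] -/
private theorem iSupIndep_of_map_subtype {ι : Type*} {U : Submodule K V} {f : ι → Submodule K U}
    (h : iSupIndep fun i ↦ (f i).map U.subtype) : iSupIndep f := by
  rw [iSupIndep_def] at h ⊢
  intro i
  have hi := h i
  rw [disjoint_iff] at hi ⊢
  apply Submodule.map_injective_of_injective U.injective_subtype
  rw [Submodule.map_inf _ U.injective_subtype, Submodule.map_bot, ← hi]
  congr 1
  simp_rw [Submodule.map_iSup]

/-- **The bigrading of an invariant subspace as an internal direct sum** `U = ⊕_{(k,l)} U_{k,l}`,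
`U_{k,l} = U ∩ M_k(A) ∩ M_l(B)` viewed inside `U`. [cite: LooijengaLunts1997, §5 (5.3) p. 21 L28–L30] -/
theorem isInternal_comap_subtype_bidegreeSpace_of_forall_mem {A B : Module.End K V} (hA : IsZGrading A)
    (hB : IsZGrading B) (hAB : A * B = B * A) {U : Submodule K V} (hUA : ∀ x ∈ U, A x ∈ U)
    (hUB : ∀ x ∈ U, B x ∈ U) :
    DirectSum.IsInternal fun p : ℤ × ℤ ↦ (degreeSpace A p.1 ⊓ degreeSpace B p.2).comap U.subtype := by
  refine DirectSum.isInternal_submodule_of_iSupIndep_of_iSup_eq_top (iSupIndep_of_map_subtype ?_) ?_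
  · simp_rw [Submodule.map_comap_subtype]
    exact iSupIndep_inf_bidegreeSpace hAB U
  · apply Submodule.map_injective_of_injective U.injective_subtype
    simp_rw [Submodule.map_iSup, Submodule.map_comap_subtype, Submodule.map_subtype_top]
    exact (eq_iSup_inf_bidegreeSpace_of_forall_mem hA hB hAB hUA hUB).symm

end Bigrading

end Literature.Algebra.Lie
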